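import Summits.ResolutionOfSingularities.ResolutionOfSingularities.Theorems.HomologicalConductorNoZenoRQuadraticTransformDominated
import Summits.ResolutionOfSingularities.ResolutionOfSingularities.Theorems.HomologicalConductorNoZenoRBlowupNormalOfCompletePowers
import Literature.AlgebraicGeometry.Resolution.RegularLocalRingsNormal
import Literature.RingTheory.IntegralClosure.IntegralClosureIdealRemarks
import Literature.RingTheory.IntegralClosure.PrincipalIdealIntegrallyClosed
import HarnessLib

/-!
# Crux `NoZenoR` (stmt-ResolutionOfSingularities-19943) — powers of `𝔪` on a desingularization of a rational surface
# singularity: `\overline{𝔪ⁿ} ⊆ Γ(X, 𝔪ⁿ𝒪_X)`, and CONTRACTEDNESS of the powers `𝔪ⁿ` (Lipman Thm. (7.2) for `I = J = 𝔪ᵏ`)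
# gives their COMPLETENESS, hence the normality of the quadratic transform (Prop. (8.1)) by Lemma (5.2)

Route `ResolutionOfSingularities/HomologicalConductor` (cell decomp-res, hand leafhand-res-homologicalconduct-22 g0).
OURS: AI-written, weaker than expert review; nothing here is a statement of the manuscript under review (Hironaka 2017).
SUPPORT level, counted 0.  Def-free, FACT-FREE (the contractedness of products enters as an explicit hypothesis).

A second, shorter road from the cohomology of a desingularization `π : X → Spec S` of a two-dimensional normal local
domain `S` with a NON-REGULAR rational singularity to the completeness of the powers `𝔪ⁿ` (the input of Lipman's
Proposition (8.1), via Lemma (5.2) = `affineBlowup.isIntegrallyClosed_stalk_of_forall_pow`), which does not go through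
Theorem (7.1) / Proposition (6.2) / Proposition (1.2) B):

* §1 `toStalk_mem_map_pow_maximalIdeal_of_integralDependence` — **`\overline{𝔪ⁿ} ⊆ Γ(X, 𝔪ⁿ𝒪_X) ∩ S`** stalkwise: if
  `r ∈ S` is integral over `𝔪ⁿ` then `r ∈ 𝔪ⁿ·𝒪_{X,x}` for every `x ∈ X`.  For `𝔪·𝒪_{X,x}` is principal (Prop. (3.1) in
  its stalkwise form, hand 21's `isPrincipal_map_maximalIdeal_toStalk`), so `𝔪ⁿ·𝒪_{X,x} = (tⁿ)` with `t ≠ 0`, the image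
  of `r` is integral over it (persistence, Huneke–Swanson 1.1.3 (7)), and principal ideals of the regular — hence
  integrally closed — local ring `𝒪_{X,x}` are integrally closed (Huneke–Swanson Prop. 1.5.2).
* §2 `mem_maximalIdeal_of_forall_toStalk_mem` — **`𝔪` is contracted for `π`**: if `r ∈ 𝔪·𝒪_{X,x}` for all `x` then
  `r ∈ 𝔪` (take `x` over the closed point, where `S → 𝒪_{X,x}` is local; `π` is onto).
* §3 `forall_pow_maximalIdeal_contracted_of_mul` — GIVEN that products of contracted ideals are contracted for `π`
  (Lipman's Theorem (7.2), p. 209, whose hypotheses `f_*𝒪_X = 𝒪_Y`, `R¹f_*𝒪_X = 0`, `X` normal hold for a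
  desingularization of a rational singularity), every power `𝔪ⁿ` is contracted; with §1,
  `forall_mem_pow_maximalIdeal_of_integralDependence_of_mul` — **every `𝔪ⁿ` is complete**; and
  `isIntegrallyClosed_stalk_affineBlowup_of_mul` — **`Bl_𝔪(Spec S)` is normal** (Lemma (5.2)).

So, for non-regular `S`, Prop. (8.1) ⟸ [Thm. (7.2) for the powers of `𝔪` on one desingularization]; the remaining input
is purely the cohomological Lemma (7.3) / Theorem (7.2) (surjectivity of `Γ(𝔪𝒪_X) ⊗ Γ(𝔪ⁿ𝒪_X) → Γ(𝔪ⁿ⁺¹𝒪_X)` from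
`H¹ = 0`), for which the tree's Čech kit (`…NoZenoRGlobalGeneratorsH1`: `H¹((t₁,…,tₙ)𝒪_X) = 0`) is the natural tool.

No crux, kill test or summit statement is proved here; resolution in positive characteristic is NOT proved.

References: J. Lipman, *Rational singularities, with applications to algebraic surfaces and unique factorization*, Publ.
Math. IHÉS 36 (1969): Definition (6.1) and p. 208 («`𝒥` is contracted for `f` iff `𝒥 = f_*(𝒥𝒪_X)`»), Theorem (7.2)
(p. 209), Proposition (8.1) (p. 212), Proposition (3.1) (p. 203) [`Lipman1969`]; C. Huneke, I. Swanson, *Integral Closure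
of Ideals, Rings, and Modules* (2006), Remark 1.1.3 (7), Proposition 1.5.2 [`HunekeSwanson2006`]; H. Matsumura,
*Commutative Ring Theory* (1986), Thm. 19.4 [`Matsumura1987`].
-/

noncomputable section

-- single-problem summit: the doubled namespace component `ResolutionOfSingularities` is forced
set_option linter.dupNamespace false

open CategoryTheory AlgebraicGeometry TopologicalSpace IsLocalRing
open Literature.AlgebraicGeometry.Resolution Literature.RingTheory.IntegralClosure

namespace Summit.ResolutionOfSingularities.ResolutionOfSingularities.Theorems.NoZeno.QuadraticTransform

variable {S : Type} [CommRing S] [IsNoetherianRing S] [IsLocalRing S] [IsDomain S] [IsIntegrallyClosed S]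
  {X : Scheme.{0}} (π : X ⟶ Spec (.of S))

/-! ## §1 `\overline{𝔪ⁿ} ⊆ Γ(X, 𝔪ⁿ𝒪_X)` -/

omit [IsNoetherianRing S] [IsDomain S] [IsIntegrallyClosed S] in
/-- `𝔪 ≠ 0` in a local ring of Krull dimension `2`. [folklore] -/
theorem maximalIdeal_ne_bot_of_ringKrullDim_eq_two (hdim : ringKrullDim S = 2) : maximalIdeal S ≠ ⊥ := by
  intro h
  have h0 := ringKrullDim_eq_zero_of_isField (IsLocalRing.isField_iff_maximalIdeal_eq.mpr h)
  rw [hdim] at h0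
  exact absurd h0 (by decide)

/-- **`\overline{𝔪ⁿ} ⊆ Γ(X, 𝔪ⁿ𝒪_X) ∩ S`, stalkwise.**  On a desingularization `π : X → Spec S` of a two-dimensional normal
local domain with a non-regular rational singularity, an element `r ∈ S` integral over `𝔪ⁿ` lies in `𝔪ⁿ·𝒪_{X,x}` for
every `x ∈ X`: `𝔪·𝒪_{X,x} = (t)` is principal (Prop. (3.1), stalkwise), so `𝔪ⁿ·𝒪_{X,x} = (tⁿ)` with `t ≠ 0`, the image
of `r` is integral over `(tⁿ)` (persistence of integral dependence), and a principal ideal of the regular, hence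
integrally closed, domain `𝒪_{X,x}` is integrally closed. [cite: Lipman1969, Proposition (3.1) (p. 203); HunekeSwanson2006, Prop. 1.5.2] -/
theorem toStalk_mem_map_pow_maximalIdeal_of_integralDependence (hdim : ringKrullDim S = 2)
    (hrat : HasRationalSingularity S) (hsing : ¬ IsRegularLocalRing S) (hπ : IsResolution π) (n : ℕ) {r : S}
    (hr : ∃ (k : ℕ) (c : ℕ → S), (∀ j ∈ Finset.Icc 1 k, c j ∈ (maximalIdeal S ^ n) ^ j) ∧
      r ^ k + ∑ j ∈ Finset.Icc 1 k, c j * r ^ (k - j) = 0)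
    (x : X) : ExcCount.toStalk π x r ∈ (maximalIdeal S ^ n).map (ExcCount.toStalk π x) := by
  haveI : IsProper π := hπ.isProper
  haveI : IsIntegral X := hπ.isIntegral_source
  haveI : IsDominant π := hπ.isBirational.isDominant
  haveI : IsRegularLocalRing (X.presheaf.stalk x) := hπ.isRegular x
  haveI : IsDomain (X.presheaf.stalk x) := isDomain_of_isRegularLocalRing (X.presheaf.stalk x)
  haveI : IsIntegrallyClosed (X.presheaf.stalk x) := isIntegrallyClosed_of_isRegularLocalRing (X.presheaf.stalk x)
  -- `𝔪·𝒪_{X,x} = (t)`, `t ≠ 0`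
  obtain ⟨t, ht⟩ := (isPrincipal_map_maximalIdeal_toStalk π hdim hrat hsing hπ x).principal
  have ht' : (maximalIdeal S).map (ExcCount.toStalk π x) = Ideal.span {t} := ht
  have ht0 : t ≠ 0 := by
    intro h0
    obtain ⟨a, ha, ha0⟩ := Submodule.exists_mem_ne_zero_of_ne_bot (maximalIdeal_ne_bot_of_ringKrullDim_eq_two hdim)
    have h1 : ExcCount.toStalk π x a ∈ (maximalIdeal S).map (ExcCount.toStalk π x) := Ideal.mem_map_of_mem _ ha
    rw [ht', h0, Ideal.span_singleton_eq_bot.mpr rfl, Ideal.mem_bot] at h1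
    exact ha0 (ExcCount.toStalk_injective π x (by rw [h1, map_zero]))
  have hpow : (maximalIdeal S ^ n).map (ExcCount.toStalk π x) = Ideal.span {t ^ n} := by
    rw [Ideal.map_pow, ht', Ideal.span_singleton_pow]
  rw [hpow]
  refine mem_span_singleton_of_integralDependence (mem_nonZeroDivisors_of_ne_zero (pow_ne_zero n ht0)) ?_
  have h := integralDependence_map (ExcCount.toStalk π x) hr
  rwa [hpow] at h

/-! ## §2 `𝔪` is contracted -/

omit [IsNoetherianRing S] [IsDomain S] [IsIntegrallyClosed S] in
/-- **`𝔪` is contracted for a desingularization** (`𝔪 = Γ(X, 𝔪𝒪_X) ∩ S`, stalkwise): if `r ∈ 𝔪·𝒪_{X,x}` for every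
`x ∈ X` then `r ∈ 𝔪` — over the closed point (the proper dominant `π` is onto) the structure map `S → 𝒪_{X,x}` is local,
so `𝔪·𝒪_{X,x} ≠ 𝒪_{X,x}` and a unit `r` could not lie in it. [cite: Lipman1969, Definition (6.1) (p. 207–208)] -/
theorem mem_maximalIdeal_of_forall_toStalk_mem (hπ : IsResolution π) {r : S}
    (hr : ∀ x : X, ExcCount.toStalk π x r ∈ (maximalIdeal S).map (ExcCount.toStalk π x)) : r ∈ maximalIdeal S := by
  haveI : IsProper π := hπ.isProper
  haveI : IsDominant π := hπ.isBirational.isDominant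
  -- a point over the closed point
  have hsurj : Function.Surjective π.base := by
    rw [← Set.range_eq_univ, ← π.isClosedMap.isClosed_range.closure_eq]
    exact π.denseRange.closure_eq
  obtain ⟨x, hx⟩ := hsurj (closedPoint S)
  haveI := ExcCount.isLocalHom_toStalk_of_base_eq π hx
  by_contra hrm
  have hru : IsUnit r := by
    by_contra hnu
    exact hrm ((IsLocalRing.mem_maximalIdeal r).mpr hnu)
  -- `𝔪·𝒪_{X,x}` lies in the maximal ideal of `𝒪_{X,x}`
  have hle : (maximalIdeal S).map (ExcCount.toStalk π x) ≤ maximalIdeal (X.presheaf.stalk x) := by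
    refine (Ideal.map_le_iff_le_comap).mpr fun t ht => ?_
    rw [Ideal.mem_comap, IsLocalRing.mem_maximalIdeal, mem_nonunits_iff]
    intro hu
    exact (IsLocalRing.mem_maximalIdeal t).mp ht ((isUnit_map_iff (ExcCount.toStalk π x) t).mp hu)
  have hmem := hle (hr x)
  exact (IsLocalRing.mem_maximalIdeal _).mp hmem (hru.map (ExcCount.toStalk π x))

/-! ## §3 Contracted products ⇒ complete powers ⇒ normal quadratic transform -/

omit [IsNoetherianRing S] [IsDomain S] [IsIntegrallyClosed S] in
/-- **Every power `𝔪ⁿ` is contracted**, GIVEN that the product of two contracted ideals is contracted for `π`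
(Lipman's Theorem (7.2) for the desingularization `π`): induction from §2 (`𝔪⁰ = S` is contracted trivially).
[cite: Lipman1969, Theorem (7.2) (p. 209)] -/
theorem forall_pow_maximalIdeal_contracted_of_mul (hπ : IsResolution π)
    (hmul : ∀ I J : Ideal S,
      (∀ r : S, (∀ x : X, ExcCount.toStalk π x r ∈ I.map (ExcCount.toStalk π x)) → r ∈ I) →
      (∀ r : S, (∀ x : X, ExcCount.toStalk π x r ∈ J.map (ExcCount.toStalk π x)) → r ∈ J) →
      ∀ r : S, (∀ x : X, ExcCount.toStalk π x r ∈ (I * J).map (ExcCount.toStalk π x)) → r ∈ I * J)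
    (n : ℕ) (r : S) (hr : ∀ x : X, ExcCount.toStalk π x r ∈ (maximalIdeal S ^ n).map (ExcCount.toStalk π x)) :
    r ∈ maximalIdeal S ^ n := by
  induction n generalizing r with
  | zero => rw [pow_zero, Ideal.one_eq_top]; exact Submodule.mem_top
  | succ n ih =>
    rw [pow_succ] at hr ⊢
    exact hmul (maximalIdeal S ^ n) (maximalIdeal S) ih
      (fun s hs => mem_maximalIdeal_of_forall_toStalk_mem π hπ hs) r hr

/-- **Every power `𝔪ⁿ` is complete** (integrally closed), GIVEN contractedness of products for a desingularization
`π` of the non-regular rational `Spec S`: `\overline{𝔪ⁿ} ⊆ Γ(X, 𝔪ⁿ𝒪_X) ∩ S` (§1) `= 𝔪ⁿ` (§3).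
[cite: Lipman1969, Theorem (7.2) (p. 209); Proposition (8.1) (p. 212)] -/
theorem forall_mem_pow_maximalIdeal_of_integralDependence_of_mul (hdim : ringKrullDim S = 2)
    (hrat : HasRationalSingularity S) (hsing : ¬ IsRegularLocalRing S) (hπ : IsResolution π)
    (hmul : ∀ I J : Ideal S,
      (∀ r : S, (∀ x : X, ExcCount.toStalk π x r ∈ I.map (ExcCount.toStalk π x)) → r ∈ I) →
      (∀ r : S, (∀ x : X, ExcCount.toStalk π x r ∈ J.map (ExcCount.toStalk π x)) → r ∈ J) →
      ∀ r : S, (∀ x : X, ExcCount.toStalk π x r ∈ (I * J).map (ExcCount.toStalk π x)) → r ∈ I * J)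
    (n : ℕ) (r : S)
    (hr : ∃ (k : ℕ) (c : ℕ → S), (∀ j ∈ Finset.Icc 1 k, c j ∈ (maximalIdeal S ^ n) ^ j) ∧
      r ^ k + ∑ j ∈ Finset.Icc 1 k, c j * r ^ (k - j) = 0) :
    r ∈ maximalIdeal S ^ n :=
  forall_pow_maximalIdeal_contracted_of_mul π hπ hmul n r
    fun x => toStalk_mem_map_pow_maximalIdeal_of_integralDependence π hdim hrat hsing hπ n hr x

/-- **Prop. (8.1) for a non-regular rational `S`, from contractedness of products on ONE desingularization**: every
local ring of the quadratic transform `Bl_𝔪(Spec S)` is an integrally closed domain (Lemma (5.2),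
`affineBlowup.isIntegrallyClosed_stalk_of_forall_pow`, applied to the complete powers `𝔪ⁿ`).
[cite: Lipman1969, Proposition (8.1) (p. 212); Lemma (5.2) (p. 206); Theorem (7.2) (p. 209)] -/
theorem isIntegrallyClosed_stalk_affineBlowup_of_mul (hdim : ringKrullDim S = 2)
    (hrat : HasRationalSingularity S) (hsing : ¬ IsRegularLocalRing S) (hπ : IsResolution π)
    (hmul : ∀ I J : Ideal S,
      (∀ r : S, (∀ x : X, ExcCount.toStalk π x r ∈ I.map (ExcCount.toStalk π x)) → r ∈ I) →
      (∀ r : S, (∀ x : X, ExcCount.toStalk π x r ∈ J.map (ExcCount.toStalk π x)) → r ∈ J) →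
      ∀ r : S, (∀ x : X, ExcCount.toStalk π x r ∈ (I * J).map (ExcCount.toStalk π x)) → r ∈ I * J)
    (y : affineBlowup (maximalIdeal S)) :
    IsIntegrallyClosed ((affineBlowup (maximalIdeal S)).presheaf.stalk y) :=
  affineBlowup.isIntegrallyClosed_stalk_of_forall_pow (maximalIdeal S)
    (forall_mem_pow_maximalIdeal_of_integralDependence_of_mul π hdim hrat hsing hπ hmul) y

/-! ## §4 (appended) The same for any ideal whose pull-back is invertible: `Ī ⊆ Γ(X, I𝒪_X) ∩ S` -/

omit [IsNoetherianRing S] [IsLocalRing S] [IsIntegrallyClosed S] in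
/-- **`Ī ⊆ Γ(X, I𝒪_X) ∩ S` for every ideal `I` whose pull-back `I𝒪_X` is invertible** (stalkwise), on any scheme
`π : X → Spec S` over the domain `S` with `X` integral, `π` quasi-compact dominant, and normal local rings `𝒪_{X,x}`: if
`I·𝒪_{X,x}` is principal for every `x` (e.g. `I` complete and `𝔪`-primary on a desingularization dominating `Bl_I`,
Lipman Prop. (1.2) B); or `I = 𝔪ⁿ` by Prop. (3.1)) and `r ∈ S` is integral over `I`, then `r ∈ I·𝒪_{X,x}` for every
`x`.  This is the inclusion `Ī ⊆ f_*(I𝒪_X)` of the first part of the proof of Lipman's Proposition (6.2) (p. 208: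
«`𝒥𝒪_X` is invertible … hence `f_*(𝒥𝒪_X) ⊇ 𝒥̄`»), for use with contractedness results beyond the powers of `𝔪`.
[cite: Lipman1969, Proposition (6.2), proof (p. 208); HunekeSwanson2006, Prop. 1.5.2] -/
theorem toStalk_mem_map_of_integralDependence_of_isPrincipal [IsIntegral X] [IsDominant π] [QuasiCompact π]
    (hN : ∀ x : X, IsIntegrallyClosed (X.presheaf.stalk x)) (hD : ∀ x : X, IsDomain (X.presheaf.stalk x))
    {I : Ideal S} (hI0 : I ≠ ⊥) (hprin : ∀ x : X, (I.map (ExcCount.toStalk π x)).IsPrincipal) {r : S}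
    (hr : ∃ (k : ℕ) (c : ℕ → S), (∀ j ∈ Finset.Icc 1 k, c j ∈ I ^ j) ∧
      r ^ k + ∑ j ∈ Finset.Icc 1 k, c j * r ^ (k - j) = 0)
    (x : X) : ExcCount.toStalk π x r ∈ I.map (ExcCount.toStalk π x) := by
  haveI := hN x
  haveI := hD x
  obtain ⟨t, ht⟩ := (hprin x).principal
  have ht' : I.map (ExcCount.toStalk π x) = Ideal.span {t} := ht
  have ht0 : t ≠ 0 := by
    intro h0
    obtain ⟨a, ha, ha0⟩ := Submodule.exists_mem_ne_zero_of_ne_bot hI0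
    have h1 : ExcCount.toStalk π x a ∈ I.map (ExcCount.toStalk π x) := Ideal.mem_map_of_mem _ ha
    rw [ht', h0, Ideal.span_singleton_eq_bot.mpr rfl, Ideal.mem_bot] at h1
    exact ha0 (ExcCount.toStalk_injective π x (by rw [h1, map_zero]))
  rw [ht']
  refine mem_span_singleton_of_integralDependence (mem_nonZeroDivisors_of_ne_zero ht0) ?_
  have h := integralDependence_map (ExcCount.toStalk π x) hr
  rwa [ht'] at h

omit [IsNoetherianRing S] [IsLocalRing S] [IsIntegrallyClosed S] in
/-- Hence, for such `I`: **if `I` is contracted for `π` then `I` is complete** (integrally closed) — the first part of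
the proof of Proposition (6.2) («`𝒥̄ = f_*(𝒥̄𝒪_X) ⊇ f_*(𝒥𝒪_X)`.  If `𝒥` is contracted for `f`, then `𝒥̄ ⊆ 𝒥`, i.e.
`𝒥` is complete»), stalkwise. [cite: Lipman1969, Proposition (6.2), proof (p. 208)] -/
theorem forall_mem_of_integralDependence_of_contracted_of_isPrincipal [IsIntegral X] [IsDominant π] [QuasiCompact π]
    (hN : ∀ x : X, IsIntegrallyClosed (X.presheaf.stalk x)) (hD : ∀ x : X, IsDomain (X.presheaf.stalk x))
    {I : Ideal S} (hI0 : I ≠ ⊥) (hprin : ∀ x : X, (I.map (ExcCount.toStalk π x)).IsPrincipal)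
    (hcontr : ∀ r : S, (∀ x : X, ExcCount.toStalk π x r ∈ I.map (ExcCount.toStalk π x)) → r ∈ I) (r : S)
    (hr : ∃ (k : ℕ) (c : ℕ → S), (∀ j ∈ Finset.Icc 1 k, c j ∈ I ^ j) ∧
      r ^ k + ∑ j ∈ Finset.Icc 1 k, c j * r ^ (k - j) = 0) :
    r ∈ I :=
  hcontr r fun x => toStalk_mem_map_of_integralDependence_of_isPrincipal π hN hD hI0 hprin hr x

end Summit.ResolutionOfSingularities.ResolutionOfSingularities.Theorems.NoZeno.QuadraticTransform

end
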